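import Summits.QuantumFields.YangMills.Theorems.UnitScaleTiltProp8IterTangent
import Literature.MathematicalPhysics.QuantumFieldTheory.Balaban1983to89.T4AvgDerivBound
import HarnessLib

/-!
# Route `UnitScaleTilt`, crux K1 «MinimiserStabilityRegPr» (stmt-QuantumFields-19200), stub `stub_prop8` (V2) — sub-lemma C_k qualitative, part U3:
# **THE (0.4)-AVERAGE IS LIPSCHITZ IN THE SUP NORM NEAR A SMALL FIELD** (`norm_avgFun_sub_avgFun_le_of_close`, `norm_iter_sub_iter_le_of_close`)

Cell `ym3-torus` ∕ fleet seat `ym-ust-19200-p2` g4.  The k-fold statements of this lineage (graph property `eq_of_iter_eq_of_agree`, Euler–Lagrange `…_iter`)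
carry closeness hypotheses at every level; this file discharges them from level `0`: for a `t`-small `U` and any `U′` with `‖U′_b − U_b‖ ≤ ρ` for all bonds
(`stokesConst·(t + 4ρ) ≤ 1/24`), `‖Ū′(c) − Ū(c)‖ ≤ 30ℓ·ρ` for every coarse bond (`ℓ = (d+2)L`; loops of (0.4) have ≤ ℓ bonds, `eml` is `(1 + 144v)`-Lipschitz on
the polydisc of radius `v ≤ 1/24` by the mean value inequality and `norm_fderiv_eml_sub_mean_le`), and by induction `‖Ū′^{(i)} − Ū^{(i)}‖ ≤ (30ℓ)^i·ρ` as long as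
the iterated averages of `U` stay `t`-small and `stokesConst·(t + 4(30ℓ)^iρ) ≤ 1/24`.  Sorry-free, no definition. [folklore] ∕ cited.
References: T. Bałaban, CMP 109 (1987) 249–301 [Balaban1987RG1] ((0.3)–(0.4) p.252); CMP 98 (1985) 17–51 [Balaban1985Averaging] (Prop. 1 p.26).
-/

noncomputable section

open scoped BigOperators Matrix.Norms.L2Operator Matrix
open Filter Function Set

namespace Summit.QuantumFields.YangMills.Theorems.Prop8Criticality

open Literature.MathematicalPhysics.QuantumFieldTheory.Balaban1983to89
open T4Continuum AveragingRT BlockAveraging BlockAveragingHaarAC BlockAveragingEMLHaarAC ExpMeanLog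
open B7TransferAnalyticMean BlockAveragingEMLAnalyticMean
open Summit.QuantumFields.YangMills.Theorems.BlockAvgCorrector (stokesConst stokesConst_nonneg emlWeight_pos emlWeight_le_one
  norm_openHol_mul_star_sub_one_le plaqSmall_of_forall_norm_sub_le)

variable {P : Params} {j : ℕ}

/-! ## §1 Holonomies are Lipschitz in the bonds -/

/-- **PARALLEL TRANSPORTS ARE LIPSCHITZ IN THE BOND VARIABLES** (`SU(2)` in `M₂(ℂ)`): if `‖U′_b − U_b‖ ≤ ρ` for every bond then along every sequence of steps
`‖U′(γ) − U(γ)‖ ≤ |γ|·ρ`. [folklore] -/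
theorem norm_coe_holAt_sub_le (U U' : GaugeField P j (Matrix.specialUnitaryGroup (Fin 2) ℂ)) {ρ : ℝ}
    (hρ : ∀ b : PBond P j, ‖((U' b : Matrix.specialUnitaryGroup (Fin 2) ℂ) : Matrix (Fin 2) (Fin 2) ℂ) - (U b : Matrix (Fin 2) (Fin 2) ℂ)‖ ≤ ρ) :
    ∀ γ : List (LStep P j), ‖((holAt U' γ : Matrix.specialUnitaryGroup (Fin 2) ℂ) : Matrix (Fin 2) (Fin 2) ℂ) -
        ((holAt U γ : Matrix.specialUnitaryGroup (Fin 2) ℂ) : Matrix (Fin 2) (Fin 2) ℂ)‖ ≤ γ.length * ρ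
  | [] => by simp [holAt_nil]
  | s :: γ => by
    have ih := norm_coe_holAt_sub_le U U' hρ γ
    rw [holAt_cons, holAt_cons, List.length_cons, Submonoid.coe_mul, Submonoid.coe_mul]
    have hstep : ‖((if s.fwd then U' s.bond else (U' s.bond)⁻¹ : Matrix.specialUnitaryGroup (Fin 2) ℂ) : Matrix (Fin 2) (Fin 2) ℂ) -
        ((if s.fwd then U s.bond else (U s.bond)⁻¹ : Matrix.specialUnitaryGroup (Fin 2) ℂ) : Matrix (Fin 2) (Fin 2) ℂ)‖ ≤ ρ := by
      rcases s with ⟨b, _ | _⟩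
      · simp only [Bool.false_eq_true, ↓reduceIte]
        show ‖star ((U' b : Matrix.specialUnitaryGroup (Fin 2) ℂ) : Matrix (Fin 2) (Fin 2) ℂ) - star ((U b : Matrix.specialUnitaryGroup (Fin 2) ℂ) : Matrix (Fin 2) (Fin 2) ℂ)‖ ≤ ρ
        rw [← star_sub, norm_star]; exact hρ b
      · simp only [↓reduceIte]; exact hρ b
    -- `‖a′b′ − ab‖ ≤ ‖a′ − a‖ + ‖b′ − b‖` for factors of norm ≤ 1
    set a' : Matrix (Fin 2) (Fin 2) ℂ := ((if s.fwd then U' s.bond else (U' s.bond)⁻¹ : Matrix.specialUnitaryGroup (Fin 2) ℂ) : Matrix (Fin 2) (Fin 2) ℂ)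
    set a : Matrix (Fin 2) (Fin 2) ℂ := ((if s.fwd then U s.bond else (U s.bond)⁻¹ : Matrix.specialUnitaryGroup (Fin 2) ℂ) : Matrix (Fin 2) (Fin 2) ℂ)
    set b' : Matrix (Fin 2) (Fin 2) ℂ := ((holAt U' γ : Matrix.specialUnitaryGroup (Fin 2) ℂ) : Matrix (Fin 2) (Fin 2) ℂ)
    set b : Matrix (Fin 2) (Fin 2) ℂ := ((holAt U γ : Matrix.specialUnitaryGroup (Fin 2) ℂ) : Matrix (Fin 2) (Fin 2) ℂ)
    have hid : a' * b' - a * b = (a' - a) * b' + a * (b' - b) := by noncomm_ring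
    rw [hid]
    have hρ0 : 0 ≤ ρ := (norm_nonneg _).trans (hρ s.bond)
    have ha1 : ‖a‖ ≤ 1 := (norm_coe_su2 _).le
    have hb1 : ‖b'‖ ≤ 1 := (norm_coe_su2 _).le
    calc ‖(a' - a) * b' + a * (b' - b)‖ ≤ ‖a' - a‖ * ‖b'‖ + ‖a‖ * ‖b' - b‖ :=
          (norm_add_le _ _).trans (add_le_add (norm_mul_le _ _) (norm_mul_le _ _))
      _ ≤ ρ * 1 + 1 * (γ.length * ρ) :=
          add_le_add (mul_le_mul hstep hb1 (norm_nonneg _) hρ0) (mul_le_mul ha1 ih (norm_nonneg _) zero_le_one)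
      _ = ((γ.length + 1 : ℕ) : ℝ) * ρ := by push_cast; ring

/-! ## §2 The exp-mean-log is Lipschitz near the identity tuple -/

section Eml

variable {ι : Type*} [Fintype ι]

/-- **`eml` IS `(1 + 144v)`-LIPSCHITZ ON THE POLYDISC OF RADIUS `v ≤ 1/24` ABOUT THE IDENTITY TUPLE** (mean value inequality along the segment; the derivative is
the arithmetic mean up to `144v`, `norm_fderiv_eml_sub_mean_le`). [folklore] -/
theorem norm_eml_sub_eml_le {T₁ T₂ : ι → Matrix (Fin 2) (Fin 2) ℂ} {v : ℝ} (hv₁ : ‖T₁ - 1‖ ≤ v) (hv₂ : ‖T₂ - 1‖ ≤ v) (hv24 : v ≤ 1 / 24) :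
    ‖eml T₂ - eml T₁‖ ≤ (1 + 144 * v) * ‖T₂ - T₁‖ := by
  have hv0 : 0 ≤ v := (norm_nonneg _).trans hv₁
  set ΔT : ι → Matrix (Fin 2) (Fin 2) ℂ := T₂ - T₁ with hΔT
  set Ts : ℝ → ι → Matrix (Fin 2) (Fin 2) ℂ := fun s => T₁ + (s : ℂ) • ΔT with hTs
  have hTsv : ∀ s : ℝ, 0 ≤ s → s ≤ 1 → ‖Ts s - 1‖ ≤ v := by
    intro s hs0 hs1
    have hconv : Ts s - 1 = ((1 - s : ℝ) : ℂ) • (T₁ - 1) + (s : ℂ) • (T₂ - 1) := by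
      rw [hTs, hΔT]; simp only []; push_cast
      module
    rw [hconv]
    calc ‖((1 - s : ℝ) : ℂ) • (T₁ - 1) + (s : ℂ) • (T₂ - 1)‖ ≤ ‖((1 - s : ℝ) : ℂ) • (T₁ - 1)‖ + ‖(s : ℂ) • (T₂ - 1)‖ := norm_add_le _ _
      _ = (1 - s) * ‖T₁ - 1‖ + s * ‖T₂ - 1‖ := by
          rw [norm_smul, norm_smul, Complex.norm_real, Complex.norm_real, Real.norm_eq_abs, Real.norm_eq_abs,
            abs_of_nonneg (by linarith), abs_of_nonneg hs0]
      _ ≤ (1 - s) * v + s * v := add_le_add (mul_le_mul_of_nonneg_left hv₁ (by linarith)) (mul_le_mul_of_nonneg_left hv₂ hs0)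
      _ = v := by ring
  have hTs1 : ∀ s : ℝ, 0 ≤ s → s ≤ 1 → ∀ i, ‖Ts s i - 1‖ < 1 := by
    intro s hs0 hs1 i
    have := (norm_le_pi_norm (Ts s - 1) i).trans (hTsv s hs0 hs1)
    rw [Pi.sub_apply, Pi.one_apply] at this
    linarith
  have hderiv : ∀ s : ℝ, 0 ≤ s → s ≤ 1 →
      HasDerivAt (fun s : ℝ => eml (Ts s)) (fderiv ℂ (eml : (ι → Matrix (Fin 2) (Fin 2) ℂ) → Matrix (Fin 2) (Fin 2) ℂ) (Ts s) ΔT) s := by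
    intro s hs0 hs1
    have heml : HasFDerivAt (eml : (ι → Matrix (Fin 2) (Fin 2) ℂ) → Matrix (Fin 2) (Fin 2) ℂ)
        (fderiv ℂ (eml : (ι → Matrix (Fin 2) (Fin 2) ℂ) → Matrix (Fin 2) (Fin 2) ℂ) (Ts s)) (Ts s) :=
      (analyticAt_eml (hTs1 s hs0 hs1)).differentiableAt.hasFDerivAt
    have hline : HasDerivAt (fun s : ℝ => T₁ + (s : ℂ) • ΔT) ΔT s := by
      have h1 : HasDerivAt (fun s : ℝ => (s : ℂ) • ΔT) ΔT s := by
        have := (hasDerivAt_id s).ofReal_comp.smul_const ΔT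
        simpa using this
      simpa using h1.const_add T₁
    have h0 : Ts s = T₁ + (s : ℂ) • ΔT := rfl
    have := (heml.restrictScalars ℝ).comp_hasDerivAt_of_eq s hline h0
    simpa [Function.comp_def, hTs] using this
  have hbound : ∀ s : ℝ, 0 ≤ s → s ≤ 1 →
      ‖fderiv ℂ (eml : (ι → Matrix (Fin 2) (Fin 2) ℂ) → Matrix (Fin 2) (Fin 2) ℂ) (Ts s) ΔT‖ ≤ (1 + 144 * v) * ‖ΔT‖ := by
    intro s hs0 hs1
    have h1 := norm_fderiv_eml_sub_mean_le (U := Ts s) ((hTsv s hs0 hs1).trans hv24) ΔT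
    have h2 : ‖meanCLM ι (Matrix (Fin 2) (Fin 2) ℂ) ΔT‖ ≤ ‖ΔT‖ := norm_meanCLM_apply_le _
    have h3 : ‖fderiv ℂ (eml : (ι → Matrix (Fin 2) (Fin 2) ℂ) → Matrix (Fin 2) (Fin 2) ℂ) (Ts s) ΔT‖ ≤
        ‖fderiv ℂ (eml : (ι → Matrix (Fin 2) (Fin 2) ℂ) → Matrix (Fin 2) (Fin 2) ℂ) (Ts s) ΔT - meanCLM ι (Matrix (Fin 2) (Fin 2) ℂ) ΔT‖ +
          ‖meanCLM ι (Matrix (Fin 2) (Fin 2) ℂ) ΔT‖ := by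
      have := norm_add_le (fderiv ℂ (eml : (ι → Matrix (Fin 2) (Fin 2) ℂ) → Matrix (Fin 2) (Fin 2) ℂ) (Ts s) ΔT - meanCLM ι (Matrix (Fin 2) (Fin 2) ℂ) ΔT)
        (meanCLM ι (Matrix (Fin 2) (Fin 2) ℂ) ΔT)
      rwa [sub_add_cancel] at this
    have h4 : 144 * ‖ΔT‖ * ‖Ts s - 1‖ ≤ 144 * v * ‖ΔT‖ := by
      have := hTsv s hs0 hs1
      calc 144 * ‖ΔT‖ * ‖Ts s - 1‖ ≤ 144 * ‖ΔT‖ * v := by gcongr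
        _ = 144 * v * ‖ΔT‖ := by ring
    nlinarith [h1, h2, h3, h4]
  have hT1' : Ts 1 = T₂ := by simp [hTs, hΔT]
  have hT0' : Ts 0 = T₁ := by simp [hTs]
  have := norm_image_sub_le_of_norm_deriv_le_segment_01' (f := fun s : ℝ => eml (Ts s))
    (f' := fun s => fderiv ℂ (eml : (ι → Matrix (Fin 2) (Fin 2) ℂ) → Matrix (Fin 2) (Fin 2) ℂ) (Ts s) ΔT)
    (fun s hs => (hderiv s hs.1 hs.2).hasDerivWithinAt) (fun s hs => hbound s hs.1 hs.2.le)
  simpa only [hT1', hT0'] using this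

end Eml

/-! ## §3 The one-step and the k-fold (0.4)-averages are Lipschitz in the sup norm near a small field -/

/-- **THE ONE-STEP (0.4)-AVERAGE IS LIPSCHITZ IN THE SUP NORM NEAR A SMALL FIELD**: `U` `t`-small, `‖U′_b − U_b‖ ≤ ρ` for all bonds,
`stokesConst·(t + 4ρ) ≤ 1/24` ⇒ `‖Ū′(c) − Ū(c)‖ ≤ 30ℓ·ρ` for every coarse bond (`ℓ = (d+2)L`). [cite: Balaban1987RG1, (0.4) p.253; Balaban1985Averaging, Prop. 1 p.26] -/
theorem norm_avgFun_sub_avgFun_le_of_close {t ρ : ℝ} (ht : 0 ≤ t) (hρ : 0 ≤ ρ) (h24 : stokesConst P * (t + 4 * ρ) ≤ 1 / 24)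
    (U U' : GaugeField P j (Matrix.specialUnitaryGroup (Fin 2) ℂ)) (hU : PlaqSmall t U)
    (hclose : ∀ b : PBond P j, ‖((U' b : Matrix.specialUnitaryGroup (Fin 2) ℂ) : Matrix (Fin 2) (Fin 2) ℂ) - (U b : Matrix (Fin 2) (Fin 2) ℂ)‖ ≤ ρ)
    (c : PBond P (j + 1)) :
    ‖((avgFun (expMeanLogSU (n := Fin 2)) U' c : Matrix.specialUnitaryGroup (Fin 2) ℂ) : Matrix (Fin 2) (Fin 2) ℂ) -
        ((avgFun (expMeanLogSU (n := Fin 2)) U c : Matrix.specialUnitaryGroup (Fin 2) ℂ) : Matrix (Fin 2) (Fin 2) ℂ)‖ ≤ 30 * (((P.d + 2) * P.L : ℕ) : ℝ) * ρ := by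
  set ℓ : ℝ := (((P.d + 2) * P.L : ℕ) : ℝ) with hℓ
  have hℓL : (P.L : ℝ) ≤ ℓ := by rw [hℓ]; exact_mod_cast Nat.le_mul_of_pos_left _ (by omega)
  have hℓ0 : 0 ≤ ℓ := Nat.cast_nonneg _
  have hst := stokesConst_nonneg P
  have hδ : (expMeanLogSU (n := Fin 2)).δ = 1 / 3 := expMeanLogSU_two_δ
  -- both fields are small at `c`
  have hU' : PlaqSmall (t + 4 * ρ) U' := plaqSmall_of_forall_norm_sub_le hU hclose
  have hv : stokesConst P * (t + 4 * ρ) ≤ 1 / 24 := h24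
  have hsmall : Small (expMeanLogSU (n := Fin 2)) U c := fun i => by
    have h1 := LatticeWordStokes.dist1_loopHol_le ht hU c i
    rw [hδ]; refine h1.trans_lt ?_; show stokesConst P * t < 1 / 3; nlinarith
  have hsmall' : Small (expMeanLogSU (n := Fin 2)) U' c := fun i => by
    have h1 := LatticeWordStokes.dist1_loopHol_le (by positivity : (0 : ℝ) ≤ t + 4 * ρ) hU' c i
    rw [hδ]; refine h1.trans_lt ?_; show stokesConst P * (t + 4 * ρ) < 1 / 3; linarith
  rw [coe_avgFun_of_small U' c hsmall', coe_avgFun_of_small U c hsmall]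
  -- the tuples of loop variables
  set T : Idx P → Matrix (Fin 2) (Fin 2) ℂ := fun i => ((loopHol U c i : Matrix.specialUnitaryGroup (Fin 2) ℂ) : Matrix (Fin 2) (Fin 2) ℂ) with hT
  set T' : Idx P → Matrix (Fin 2) (Fin 2) ℂ := fun i => ((loopHol U' c i : Matrix.specialUnitaryGroup (Fin 2) ℂ) : Matrix (Fin 2) (Fin 2) ℂ) with hT'
  have hTv : ‖T - 1‖ ≤ stokesConst P * (t + 4 * ρ) := by
    refine (pi_norm_le_iff_of_nonneg (by positivity)).mpr fun i => ?_
    rw [Pi.sub_apply, Pi.one_apply]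
    have h1 := LatticeWordStokes.dist1_loopHol_le ht hU c i
    rw [SU2Mean.dist1_eq_norm] at h1
    refine h1.trans ?_; show stokesConst P * t ≤ stokesConst P * (t + 4 * ρ); nlinarith
  have hTv' : ‖T' - 1‖ ≤ stokesConst P * (t + 4 * ρ) := by
    refine (pi_norm_le_iff_of_nonneg (by positivity)).mpr fun i => ?_
    rw [Pi.sub_apply, Pi.one_apply]
    have h1 := LatticeWordStokes.dist1_loopHol_le (by positivity : (0 : ℝ) ≤ t + 4 * ρ) hU' c i
    rw [SU2Mean.dist1_eq_norm] at h1
    exact h1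
  have hTT : ‖T' - T‖ ≤ ℓ * ρ := by
    refine (pi_norm_le_iff_of_nonneg (by positivity)).mpr fun i => ?_
    rw [Pi.sub_apply, hT, hT']
    unfold BlockAveraging.loopHol
    refine (norm_coe_holAt_sub_le U U' hclose _).trans ?_
    rw [T4AvgDerivBound.length_walk]
    have := LatticeWordStokes.length_loopWord_le c i
    have hlen : ((loopWord P.L c.dir (off i.1) i.2.1 i.2.2).length : ℝ) ≤ ℓ := by rw [hℓ]; exact_mod_cast this
    exact mul_le_mul_of_nonneg_right hlen hρ
  have heml := norm_eml_sub_eml_le hTv hTv' hv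
  have heml1 : ‖eml T - 1‖ ≤ 1 := by
    have hV : ‖T - 1‖ ≤ 1 / 12 := hTv.trans (hv.trans (by norm_num))
    have h1 := norm_eml_one_add_sub_sub_mean_le (V := T - 1) hV
    rw [add_sub_cancel] at h1
    have h2 := norm_meanCLM_apply_le (ι := Idx P) (𝔄 := Matrix (Fin 2) (Fin 2) ℂ) (T - 1)
    have h3 : ‖eml T - 1‖ ≤ ‖eml T - 1 - meanCLM (Idx P) (Matrix (Fin 2) (Fin 2) ℂ) (T - 1)‖ + ‖meanCLM (Idx P) (Matrix (Fin 2) (Fin 2) ℂ) (T - 1)‖ := by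
      have := norm_add_le (eml T - 1 - meanCLM (Idx P) (Matrix (Fin 2) (Fin 2) ℂ) (T - 1)) (meanCLM (Idx P) (Matrix (Fin 2) (Fin 2) ℂ) (T - 1))
      rwa [sub_add_cancel] at this
    nlinarith [h1, h2, h3, hTv, hv, norm_nonneg (T - 1)]
  have hemlT : ‖eml T‖ ≤ 2 := by
    have := norm_add_le (eml T - 1) (1 : Matrix (Fin 2) (Fin 2) ℂ)
    rw [sub_add_cancel, norm_one] at this
    linarith
  -- the straight transporters
  have hax : ‖((axialAvg U' c : Matrix.specialUnitaryGroup (Fin 2) ℂ) : Matrix (Fin 2) (Fin 2) ℂ) - ((axialAvg U c : Matrix.specialUnitaryGroup (Fin 2) ℂ) : Matrix (Fin 2) (Fin 2) ℂ)‖ ≤ ℓ * ρ := by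
    rw [axialAvg_eq_holAt_walk, axialAvg_eq_holAt_walk]
    refine (norm_coe_holAt_sub_le U U' hclose _).trans ?_
    rw [T4AvgDerivBound.length_walk, List.length_replicate]
    exact mul_le_mul_of_nonneg_right hℓL hρ
  -- assemble
  have hid : eml T' * ((axialAvg U' c : Matrix.specialUnitaryGroup (Fin 2) ℂ) : Matrix (Fin 2) (Fin 2) ℂ) -
      eml T * ((axialAvg U c : Matrix.specialUnitaryGroup (Fin 2) ℂ) : Matrix (Fin 2) (Fin 2) ℂ) =
      (eml T' - eml T) * ((axialAvg U' c : Matrix.specialUnitaryGroup (Fin 2) ℂ) : Matrix (Fin 2) (Fin 2) ℂ) +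
        eml T * (((axialAvg U' c : Matrix.specialUnitaryGroup (Fin 2) ℂ) : Matrix (Fin 2) (Fin 2) ℂ) - ((axialAvg U c : Matrix.specialUnitaryGroup (Fin 2) ℂ) : Matrix (Fin 2) (Fin 2) ℂ)) := by
    noncomm_ring
  rw [hid]
  have h144 : 1 + 144 * (stokesConst P * (t + 4 * ρ)) ≤ 7 := by linarith
  calc _ ≤ ‖eml T' - eml T‖ * ‖((axialAvg U' c : Matrix.specialUnitaryGroup (Fin 2) ℂ) : Matrix (Fin 2) (Fin 2) ℂ)‖ +
        ‖eml T‖ * ‖((axialAvg U' c : Matrix.specialUnitaryGroup (Fin 2) ℂ) : Matrix (Fin 2) (Fin 2) ℂ) - ((axialAvg U c : Matrix.specialUnitaryGroup (Fin 2) ℂ) : Matrix (Fin 2) (Fin 2) ℂ)‖ :=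
        (norm_add_le _ _).trans (add_le_add (norm_mul_le _ _) (norm_mul_le _ _))
    _ ≤ (1 + 144 * (stokesConst P * (t + 4 * ρ))) * (ℓ * ρ) * 1 + 2 * (ℓ * ρ) := by
        gcongr
        · exact heml.trans (mul_le_mul_of_nonneg_left hTT (by positivity))
        · exact (norm_coe_su2 _).le
    _ ≤ 7 * (ℓ * ρ) * 1 + 2 * (ℓ * ρ) := by gcongr
    _ ≤ 30 * ℓ * ρ := by nlinarith [mul_nonneg hℓ0 hρ]

/-- **THE k-FOLD (0.4)-AVERAGE IS LIPSCHITZ IN THE SUP NORM**: if the iterated averages `Ū^{(i)}`, `i < n`, are `t`-small and `‖U′_b − U_b‖ ≤ ρ` for all finest bonds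
with `stokesConst·(t + 4(30ℓ)^{n−1}… ) ≤ 1/24` (stated as `stokesConst·(t + 4(30ℓ)^n ρ) ≤ 1/24`, `30ℓ ≥ 1`), then `‖Ū′^{(n)}(c) − Ū^{(n)}(c)‖ ≤ (30ℓ)^n·ρ`.
[cite: Balaban1987RG1, (0.11) p.253] -/
theorem norm_iter_sub_iter_le_of_close {t ρ : ℝ} (ht : 0 ≤ t) (hρ : 0 ≤ ρ) (U U' : GaugeField P 0 (Matrix.specialUnitaryGroup (Fin 2) ℂ))
    (hclose : ∀ b : PBond P 0, ‖((U' b : Matrix.specialUnitaryGroup (Fin 2) ℂ) : Matrix (Fin 2) (Fin 2) ℂ) - (U b : Matrix (Fin 2) (Fin 2) ℂ)‖ ≤ ρ) :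
    ∀ n : ℕ, (∀ i, i < n → PlaqSmall t (Averaging.iter (fun i => blockAvg (P := P) (j := i) (expMeanLogSU (n := Fin 2))) i U)) →
      stokesConst P * (t + 4 * ((30 * (((P.d + 2) * P.L : ℕ) : ℝ)) ^ n * ρ)) ≤ 1 / 24 →
      ∀ c : PBond P n, ‖((Averaging.iter (fun i => blockAvg (P := P) (j := i) (expMeanLogSU (n := Fin 2))) n U' c :
          Matrix.specialUnitaryGroup (Fin 2) ℂ) : Matrix (Fin 2) (Fin 2) ℂ) -
        ((Averaging.iter (fun i => blockAvg (P := P) (j := i) (expMeanLogSU (n := Fin 2))) n U c :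
          Matrix.specialUnitaryGroup (Fin 2) ℂ) : Matrix (Fin 2) (Fin 2) ℂ)‖ ≤
        (30 * (((P.d + 2) * P.L : ℕ) : ℝ)) ^ n * ρ := by
  intro n
  induction n with
  | zero =>
    intro _ _ c
    rw [iter_zero_apply, iter_zero_apply, pow_zero, one_mul]
    exact hclose c
  | succ n ih =>
    intro hsm h24 c
    have hst := stokesConst_nonneg P
    have hq1 : 1 ≤ 30 * (((P.d + 2) * P.L : ℕ) : ℝ) := by
      have : (1 : ℝ) ≤ (((P.d + 2) * P.L : ℕ) : ℝ) := by
        exact_mod_cast Nat.one_le_iff_ne_zero.mpr (Nat.mul_ne_zero (by omega) (by have := P.hL.2; omega))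
      linarith
    set ρn : ℝ := (30 * (((P.d + 2) * P.L : ℕ) : ℝ)) ^ n * ρ with hρn
    have hρn0 : 0 ≤ ρn := by positivity
    have hmono : ρn ≤ (30 * (((P.d + 2) * P.L : ℕ) : ℝ)) ^ (n + 1) * ρ := by
      rw [hρn, pow_succ]
      have : (30 * (((P.d + 2) * P.L : ℕ) : ℝ)) ^ n * ρ * 1 ≤ (30 * (((P.d + 2) * P.L : ℕ) : ℝ)) ^ n * ρ * (30 * (((P.d + 2) * P.L : ℕ) : ℝ)) :=
        mul_le_mul_of_nonneg_left hq1 (by positivity)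
      linarith
    have h24n : stokesConst P * (t + 4 * ρn) ≤ 1 / 24 := le_trans (by nlinarith) h24
    have ih' := ih (fun i hi => hsm i (Nat.lt_succ_of_lt hi)) h24n
    rw [iter_succ_eq_avgFun, iter_succ_eq_avgFun]
    calc _ ≤ 30 * (((P.d + 2) * P.L : ℕ) : ℝ) * ρn :=
          norm_avgFun_sub_avgFun_le_of_close ht hρn0 h24n _ _ (hsm n (Nat.lt_succ_self n)) ih' c
      _ = (30 * (((P.d + 2) * P.L : ℕ) : ℝ)) ^ (n + 1) * ρ := by rw [hρn, pow_succ]; ring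

end Summit.QuantumFields.YangMills.Theorems.Prop8Criticality

end
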